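import Mathlib.Analysis.Matrix.PosDef
import Mathlib.Analysis.Matrix.Spectrum
import Mathlib.LinearAlgebra.Matrix.Gershgorin
import Mathlib.LinearAlgebra.Matrix.PosDef
import Mathlib.LinearAlgebra.Matrix.SchurComplement
import HarnessLib

/-!
# The dominant-split certificate: a Hermitian matrix is positive semidefinite as soon as its «high» block is row-diagonally
# dominant with margins `e` and the Schur-type correction `A − C·diag(e)⁻¹·Cᴴ` of its «low» block is positive semidefinite

Topic `Literature/Computation/Certificates` (family `hubbard`; seat hubbard-box-p3, S2 CERTIFIER-FAMILIES). Kernel floor certificates for cluster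
Hamiltonians (`HubbardOpenBoxCodedClusterCertificate`: `LDLᵀ`/Gram rows checked by `decide`) cost `n³/3` integer operations per spin sector of
dimension `n`; at `n ≈ 5000` (the `2 × 4` one-band cluster, the `Cu₄O₄` ring of the three-band model) that is out of reach. Gershgorin's theorem
alone is too weak (the hopping row sums exceed the spectral gap above the certified level), but MOST configurations of a sector lie far above the
level: this file proves the classical two-block criterion that lets a certificate run the cubic step on the few «low» configurations only.

For a Hermitian block matrix `M = [[A, C], [Cᴴ, B]]` and positive margins `e` on the `B`-indices:

* §1 `posSemidef_of_rowDominant` — a Hermitian matrix with `Σ_{j ≠ i} ‖M i j‖ ≤ Re (M i i)` for every row is positive semidefinite (Gershgorin's discs,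
  Mathlib `eigenvalue_mem_ball`, and the spectral characterisation `posSemidef_iff_eigenvalues_nonneg`);
* §2 `posSemidef_fromBlocks_zero` (block-diagonal), `inv_diagonal_ofReal` and **`posSemidef_fromBlocks_of_schurSplit`**: if `E = diag(e)`, `B − E ⪰ 0` and
  `A − C E⁻¹ Cᴴ ⪰ 0` then `M ⪰ 0` (`M = [[A, C], [Cᴴ, E]] + [[0, 0], [0, B − E]]`, Mathlib's Schur-complement criterion `PosSemidef.fromBlocks₂₂` for the first summand);
* §3 **`posSemidef_fromBlocks_of_dominantSplit`**: `B − E ⪰ 0` discharged by ROW DOMINANCE INSIDE `B` (`Σ_{j ≠ i} ‖B i j‖ + e i ≤ Re (B i i)` — the couplings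
  to `A` do not enter), so the whole certificate is: margins `e > 0` checked row by row on the high block, plus ONE positive-semidefiniteness fact for the
  `|A| × |A|` matrix `A − C diag(e)⁻¹ Cᴴ` (entries `A a a' − Σ_b C a b · conj(C a' b) / e b`, `schurSplit_apply`);
* §4 the same for ONE matrix `M : Matrix ι ι 𝕜` split by a decidable predicate `p` (low = `{i // p i}`, high = `{i // ¬ p i}`): **`posSemidef_of_dominantSplit`**.

WHY (numbers, seat table EMERY-WINDOWS-g18 / kit j306820, floats): for the `Cu₄O₄` ring window of the three-band model at the La₂CuO₄ corners the
45 spin sectors (largest 4900, 3920, 3136) need `Σ n³/3 ≈ 1.2·10¹¹` operations by plain `LDLᵀ`; with the split at the certified level every sector of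
dimension `> 800` passes with a low block of at most a few hundred configurations (`(4,4)`: 4900 → 113; `(4,5)`: 3920 → 264; `(5,5)`: 3136 → 540), total
`≈ 4·10⁸` including dense fall-backs on the two near-degenerate small sectors — the cost class of the certified `2 × 3` one-band points.
Everything here is PROVED; no definition beyond the explicit Schur matrix `schurSplit`; no number is asserted.

## Mathlib / tree search

REUSED: Mathlib `eigenvalue_mem_ball` (Gershgorin), `Matrix.IsHermitian.posSemidef_iff_eigenvalues_nonneg`, `Matrix.IsHermitian.mulVec_eigenvectorBasis`,
`Matrix.PosSemidef.fromBlocks₂₂` (Schur complement), `Matrix.posDef_diagonal_iff`, `Matrix.PosDef.isUnit`, `Matrix.inv_eq_right_inv`, `Matrix.fromBlocks_add`,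
`Matrix.fromBlocks_mulVec`, `Matrix.posSemidef_submatrix_equiv`, `Matrix.fromBlocks_toBlocks`, `Equiv.sumCompl`. Tree: `HubbardSectorEnclosureCertificate`
(`posSemidef_sub_of_gram_certificate`: Gram + UNIFORM row-sum remainder) is the unsplit cousin; `lean search 'schurSplit|dominantSplit|rowDominant'` (2026-08-28): nothing.

## References

* R. A. Horn, C. R. Johnson, *Matrix Analysis* (2nd ed., 2013), Thm. 6.1.1 (Gershgorin) and §7.7 (Schur complements and positivity, Thm. 7.7.7).
  [cite: HornJohnson2013, Thm. 6.1.1] [cite: HornJohnson2013, Observation 7.1.2]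
* G. H. Golub, C. F. Van Loan, *Matrix Computations* (4th ed., 2013), §7.2.1 Thm 7.2.1. [cite: GolubVanLoan2013, §7.2.1 Thm 7.2.1]
-/

noncomputable section

open Finset Matrix
open scoped BigOperators ComplexOrder

namespace Literature.Computation.Certificates

variable {𝕜 : Type*} [RCLike 𝕜]
variable {m n : Type*} [Fintype m] [Fintype n] [DecidableEq n]

/-! ### §1 Row dominance ⇒ positive semidefinite (Gershgorin) -/

/-- **A Hermitian, row-diagonally-dominant matrix is positive semidefinite**: if `Σ_{j ≠ i} ‖M i j‖ ≤ Re (M i i)` for every `i` then `M ⪰ 0`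
(every eigenvalue lies in a Gershgorin disc, hence is `≥ 0`). [cite: HornJohnson2013, Thm. 6.1.1] -/
theorem posSemidef_of_rowDominant {M : Matrix n n 𝕜} (hM : M.IsHermitian)
    (hdom : ∀ i, ∑ j ∈ univ.erase i, ‖M i j‖ ≤ RCLike.re (M i i)) : M.PosSemidef := by
  rw [hM.posSemidef_iff_eigenvalues_nonneg]
  intro i
  -- the `i`-th eigenvalue is an eigenvalue of `toLin' M`
  have hv : (⇑(hM.eigenvectorBasis i) : n → 𝕜) ≠ 0 := fun h => by
    have h1 := (hM.eigenvectorBasis).orthonormal.1 i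
    have h2 : (hM.eigenvectorBasis i : EuclideanSpace 𝕜 n) = 0 := by
      ext j; exact congrFun h j
    rw [h2, norm_zero] at h1
    exact zero_ne_one h1
  have heig : Matrix.toLin' M (⇑(hM.eigenvectorBasis i)) = ((hM.eigenvalues i : ℝ) : 𝕜) • ⇑(hM.eigenvectorBasis i) := by
    rw [Matrix.toLin'_apply, hM.mulVec_eigenvectorBasis i, RCLike.real_smul_eq_coe_smul (K := 𝕜)]
  have hμ : Module.End.HasEigenvalue (Matrix.toLin' M) ((hM.eigenvalues i : ℝ) : 𝕜) :=
    Module.End.hasEigenvalue_of_hasEigenvector (Module.End.hasEigenvector_iff.mpr ⟨Module.End.mem_eigenspace_iff.mpr heig, hv⟩)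
  obtain ⟨k, hk⟩ := eigenvalue_mem_ball hμ
  rw [Metric.mem_closedBall, dist_eq_norm] at hk
  have hre : RCLike.re (M k k) - hM.eigenvalues i ≤ ‖((hM.eigenvalues i : ℝ) : 𝕜) - M k k‖ := by
    have h1 := RCLike.re_le_norm (M k k - ((hM.eigenvalues i : ℝ) : 𝕜))
    rw [map_sub, RCLike.ofReal_re, ← norm_neg, neg_sub] at h1
    exact h1
  have := hdom k
  simp only [Pi.zero_apply]
  linarith

/-! ### §2 The Schur split -/

omit [DecidableEq n] in
/-- A block-diagonal matrix with positive semidefinite blocks is positive semidefinite. [cite: HornJohnson2013, Observation 7.1.2] -/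
theorem posSemidef_fromBlocks_zero {S : Matrix m m 𝕜} {T : Matrix n n 𝕜} (hS : S.PosSemidef) (hT : T.PosSemidef) :
    (fromBlocks S 0 0 T).PosSemidef := by
  refine PosSemidef.of_dotProduct_mulVec_nonneg ?_ fun x => ?_
  · have h := IsHermitian.fromBlocks hS.1 (show (0 : Matrix m n 𝕜)ᴴ = 0 by simp) hT.1
    simpa using h
  · rw [fromBlocks_mulVec, dotProduct]
    simp only [Fintype.sum_sum_type, Sum.elim_inl, Sum.elim_inr, zero_mulVec, add_zero, zero_add, Pi.star_apply]
    have h1 : 0 ≤ ∑ a : m, star (x (Sum.inl a)) * (S *ᵥ fun i => x (Sum.inl i)) a := by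
      have := hS.dotProduct_mulVec_nonneg (fun i => x (Sum.inl i))
      simpa [dotProduct] using this
    have h2 : 0 ≤ ∑ b : n, star (x (Sum.inr b)) * (T *ᵥ fun i => x (Sum.inr i)) b := by
      have := hT.dotProduct_mulVec_nonneg (fun i => x (Sum.inr i))
      simpa [dotProduct] using this
    exact add_nonneg h1 h2

/-- The inverse of a real positive diagonal is the diagonal of the inverses. [cite: GolubVanLoan2013, §7.2.1 Thm 7.2.1] -/
theorem inv_diagonal_ofReal {e : n → ℝ} (he : ∀ i, 0 < e i) :
    (diagonal fun i => ((e i : ℝ) : 𝕜))⁻¹ = diagonal fun i => (((e i)⁻¹ : ℝ) : 𝕜) := by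
  refine Matrix.inv_eq_right_inv ?_
  rw [diagonal_mul_diagonal, ← diagonal_one]
  congr 1
  funext i
  rw [← RCLike.ofReal_mul, mul_inv_cancel₀ (he i).ne', RCLike.ofReal_one]

/-- **THE SCHUR SPLIT.** `E = diag(e)` with `e > 0`, `B − E ⪰ 0` and `A − C E⁻¹ Cᴴ ⪰ 0` imply `[[A, C], [Cᴴ, B]] ⪰ 0`
(`M = [[A, C], [Cᴴ, E]] + [[0, 0], [0, B − E]]`, the first summand by the Schur-complement criterion). [cite: HornJohnson2013, Observation 7.1.2] -/
theorem posSemidef_fromBlocks_of_schurSplit (A : Matrix m m 𝕜) (C : Matrix m n 𝕜) (B : Matrix n n 𝕜) {e : n → ℝ} (he : ∀ i, 0 < e i)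
    (hBE : (B - diagonal fun i => ((e i : ℝ) : 𝕜)).PosSemidef)
    (hS : (A - C * (diagonal fun i => (((e i)⁻¹ : ℝ) : 𝕜)) * Cᴴ).PosSemidef) :
    (fromBlocks A C Cᴴ B).PosSemidef := by
  set E : Matrix n n 𝕜 := diagonal fun i => ((e i : ℝ) : 𝕜) with hE
  have hEpd : E.PosDef := by
    rw [hE, posDef_diagonal_iff]
    intro i
    exact_mod_cast he i
  letI : Invertible E := hEpd.isUnit.invertible
  have h1 : (fromBlocks A C Cᴴ E).PosSemidef := by
    rw [PosDef.fromBlocks₂₂ A C hEpd, hE, inv_diagonal_ofReal he]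
    exact hS
  have h2 : (fromBlocks (0 : Matrix m m 𝕜) 0 0 (B - E)).PosSemidef := posSemidef_fromBlocks_zero PosSemidef.zero hBE
  have h := h1.add h2
  rw [fromBlocks_add, add_zero, add_zero, add_zero, add_sub_cancel] at h
  exact h

/-! ### §3 The dominant split -/

/-- **The explicit Schur matrix of the split**: `S a a' = A a a' − Σ_b C a b · conj(C a' b) / e b`. [cite: HornJohnson2013, Observation 7.1.2] -/
def schurSplit (A : Matrix m m 𝕜) (C : Matrix m n 𝕜) (e : n → ℝ) : Matrix m m 𝕜 :=
  fun a a' => A a a' - ∑ b, C a b * star (C a' b) / ((e b : ℝ) : 𝕜)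

omit [Fintype m] in
/-- `schurSplit A C e = A − C·diag(e)⁻¹·Cᴴ`. [cite: HornJohnson2013, Observation 7.1.2] -/
theorem schurSplit_eq (A : Matrix m m 𝕜) (C : Matrix m n 𝕜) (e : n → ℝ) :
    schurSplit A C e = A - C * (diagonal fun i => (((e i)⁻¹ : ℝ) : 𝕜)) * Cᴴ := by
  ext a a'
  rw [Matrix.sub_apply, Matrix.mul_apply]
  simp only [schurSplit, Matrix.mul_diagonal, Matrix.conjTranspose_apply]
  congr 1
  refine Finset.sum_congr rfl fun b _ => ?_
  rw [RCLike.ofReal_inv, div_eq_mul_inv]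
  ring

/-- **THE DOMINANT SPLIT for a block matrix.** If the high block `B` is Hermitian and row dominant INSIDE ITSELF with margins `e > 0`
(`Σ_{j ≠ i} ‖B i j‖ + e i ≤ Re (B i i)`), `A` is Hermitian, and the `|A| × |A|` matrix `schurSplit A C e` is positive semidefinite, then
`[[A, C], [Cᴴ, B]] ⪰ 0`. [cite: HornJohnson2013, Thm. 6.1.1] [cite: HornJohnson2013, Observation 7.1.2] -/
theorem posSemidef_fromBlocks_of_dominantSplit (A : Matrix m m 𝕜) (C : Matrix m n 𝕜) {B : Matrix n n 𝕜} (hB : B.IsHermitian)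
    {e : n → ℝ} (he : ∀ i, 0 < e i) (hdom : ∀ i, ∑ j ∈ univ.erase i, ‖B i j‖ + e i ≤ RCLike.re (B i i))
    (hS : (schurSplit A C e).PosSemidef) : (fromBlocks A C Cᴴ B).PosSemidef := by
  refine posSemidef_fromBlocks_of_schurSplit A C B he ?_ (by rw [← schurSplit_eq]; exact hS)
  refine posSemidef_of_rowDominant (hB.sub (isHermitian_diagonal_of_self_adjoint _ (funext fun i => by simp))) fun i => ?_
  have hoff : ∑ j ∈ univ.erase i, ‖(B - diagonal fun i => ((e i : ℝ) : 𝕜)) i j‖ = ∑ j ∈ univ.erase i, ‖B i j‖ :=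
    Finset.sum_congr rfl fun j hj => by rw [Matrix.sub_apply, diagonal_apply_ne _ (Finset.ne_of_mem_erase hj).symm, sub_zero]
  rw [hoff, Matrix.sub_apply, diagonal_apply_eq, map_sub, RCLike.ofReal_re]
  linarith [hdom i]

/-! ### §4 One matrix, split by a predicate -/

/-- **THE DOMINANT-SPLIT CERTIFICATE** for a Hermitian `M : Matrix ι ι 𝕜` and a decidable predicate `p` (LOW indices `p i`, HIGH indices `¬ p i`):
margins `e > 0` with row dominance of the high rows INSIDE the high block, and positive semidefiniteness of the low Schur matrix
`S a a' = M a a' − Σ_{b high} M a b · conj(M a' b) / e b`, give `M ⪰ 0`. [cite: HornJohnson2013, Thm. 6.1.1] [cite: HornJohnson2013, Observation 7.1.2] -/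
theorem posSemidef_of_dominantSplit {ι : Type*} [Fintype ι] [DecidableEq ι] {M : Matrix ι ι 𝕜} (hM : M.IsHermitian)
    (p : ι → Prop) [DecidablePred p] {e : {i // ¬ p i} → ℝ} (he : ∀ b, 0 < e b)
    (hdom : ∀ b : {i // ¬ p i}, ∑ b' ∈ univ.erase b, ‖M b b'‖ + e b ≤ RCLike.re (M b b))
    (hS : (schurSplit (fun a a' : {i // p i} => M a a') (fun (a : {i // p i}) (b : {i // ¬ p i}) => M a b) e).PosSemidef) :
    M.PosSemidef := by
  set σ := Equiv.sumCompl p with hσ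
  rw [← posSemidef_submatrix_equiv σ]
  have hsplit : M.submatrix σ σ = fromBlocks (fun a a' : {i // p i} => M a a') (fun (a : {i // p i}) (b : {i // ¬ p i}) => M a b)
      (fun (a : {i // p i}) (b : {i // ¬ p i}) => M a b)ᴴ (fun b b' : {i // ¬ p i} => M b b') := by
    ext (a | b) (a' | b')
    · rfl
    · rfl
    · simp only [submatrix_apply, fromBlocks_apply₂₁, conjTranspose_apply, hσ, Equiv.sumCompl_apply_inr, Equiv.sumCompl_apply_inl]
      exact (hM.apply _ _).symm
    · rfl
  rw [hsplit]
  exact posSemidef_fromBlocks_of_dominantSplit _ _ (Matrix.IsHermitian.ext fun b b' => hM.apply b b') he hdom hS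

/-! ### §5 Integer-friendly readings: a uniform margin, and clearing denominators -/

omit [DecidableEq n] in
/-- Scaling by a nonnegative real keeps positive semidefiniteness (so `L·S ⪰ 0` for an integer multiple `L·S` certifies `S ⪰ 0` after dividing).
[cite: HornJohnson2013, Observation 7.1.2] -/
theorem posSemidef_of_smul_pos {S : Matrix m m 𝕜} {c : ℝ} (hc : 0 < c) (h : (((c : ℝ) : 𝕜) • S).PosSemidef) : S.PosSemidef := by
  refine PosSemidef.of_dotProduct_mulVec_nonneg ?_ fun x => ?_
  · have h1 := h.1
    have hc' : ((c : ℝ) : 𝕜) ≠ 0 := by exact_mod_cast hc.ne'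
    have : S = (((c⁻¹ : ℝ) : 𝕜)) • ((((c : ℝ) : 𝕜)) • S) := by
      rw [smul_smul, ← RCLike.ofReal_mul, inv_mul_cancel₀ hc.ne', RCLike.ofReal_one, one_smul]
    rw [this]
    exact IsSelfAdjoint.smul (by rw [IsSelfAdjoint, RCLike.star_def, RCLike.conj_ofReal]) h1
  · have h2 := h.dotProduct_mulVec_nonneg x
    rw [Matrix.smul_mulVec, dotProduct_smul, smul_eq_mul] at h2
    rw [RCLike.nonneg_iff] at h2 ⊢
    rw [RCLike.re_ofReal_mul, RCLike.im_ofReal_mul] at h2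
    exact ⟨(mul_nonneg_iff_of_pos_left hc).mp h2.1, (mul_eq_zero.mp h2.2).resolve_left hc.ne'⟩

omit [Fintype m] [DecidableEq n] in
/-- With a UNIFORM margin `e` the Schur matrix clears its denominator: `schurSplit A C (fun _ => e) = e⁻¹ • (e • A − C Cᴴ)`.
[cite: HornJohnson2013, Observation 7.1.2] -/
theorem schurSplit_const (A : Matrix m m 𝕜) (C : Matrix m n 𝕜) (e : ℝ) (he : 0 < e) :
    schurSplit A C (fun _ => e) = (((e⁻¹ : ℝ) : 𝕜)) • ((((e : ℝ) : 𝕜)) • A - C * Cᴴ) := by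
  ext a a'
  have hc : ((e : ℝ) : 𝕜) ≠ 0 := by exact_mod_cast he.ne'
  rw [Matrix.smul_apply, Matrix.sub_apply, Matrix.smul_apply, Matrix.mul_apply]
  simp only [schurSplit, Matrix.conjTranspose_apply, smul_eq_mul, RCLike.ofReal_inv]
  rw [mul_sub, ← mul_assoc, inv_mul_cancel₀ hc, one_mul, Finset.mul_sum]
  congr 1
  refine Finset.sum_congr rfl fun b _ => ?_
  rw [div_eq_mul_inv]
  ring

/-- **UNIFORM-MARGIN DOMINANT SPLIT (integer-friendly).** One margin `e > 0` for all high rows (`Σ_{j ≠ i} ‖B i j‖ + e ≤ Re (B i i)` inside `B`) and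
`e·A − C Cᴴ ⪰ 0` (an integer matrix when `e`, `A`, `C` are integer tables) give `[[A, C], [Cᴴ, B]] ⪰ 0`.
[cite: HornJohnson2013, Thm. 6.1.1] [cite: HornJohnson2013, Observation 7.1.2] -/
theorem posSemidef_fromBlocks_of_uniformSplit (A : Matrix m m 𝕜) (C : Matrix m n 𝕜) {B : Matrix n n 𝕜} (hB : B.IsHermitian)
    {e : ℝ} (he : 0 < e) (hdom : ∀ i, ∑ j ∈ univ.erase i, ‖B i j‖ + e ≤ RCLike.re (B i i))
    (hS : ((((e : ℝ) : 𝕜)) • A - C * Cᴴ).PosSemidef) : (fromBlocks A C Cᴴ B).PosSemidef := by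
  refine posSemidef_fromBlocks_of_dominantSplit A C hB (e := fun _ => e) (fun _ => he) hdom ?_
  rw [schurSplit_const A C e he]
  refine posSemidef_of_smul_pos he ?_
  rw [smul_smul, ← RCLike.ofReal_mul, mul_inv_cancel₀ he.ne', RCLike.ofReal_one, one_smul]
  exact hS

/-- **UNIFORM-MARGIN DOMINANT SPLIT for one matrix split by a predicate.** [cite: HornJohnson2013, Thm. 6.1.1] [cite: HornJohnson2013, Observation 7.1.2] -/
theorem posSemidef_of_uniformSplit {ι : Type*} [Fintype ι] [DecidableEq ι] {M : Matrix ι ι 𝕜} (hM : M.IsHermitian)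
    (p : ι → Prop) [DecidablePred p] {e : ℝ} (he : 0 < e)
    (hdom : ∀ b : {i // ¬ p i}, ∑ b' ∈ univ.erase b, ‖M b b'‖ + e ≤ RCLike.re (M b b))
    (hS : ((((e : ℝ) : 𝕜)) • (Matrix.of fun a a' : {i // p i} => M a a') -
      (Matrix.of fun (a : {i // p i}) (b : {i // ¬ p i}) => M a b) * (Matrix.of fun (a : {i // p i}) (b : {i // ¬ p i}) => M a b)ᴴ).PosSemidef) :
    M.PosSemidef := by
  refine posSemidef_of_dominantSplit hM p (e := fun _ => e) (fun _ => he) hdom ?_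
  rw [schurSplit_const _ _ e he]
  refine posSemidef_of_smul_pos he ?_
  rw [smul_smul, ← RCLike.ofReal_mul, mul_inv_cancel₀ he.ne', RCLike.ofReal_one, one_smul]
  exact hS

/-! ### §6 Device-ready INTEGER forms: every hypothesis but the low-block certificate is a decidable integer fact -/

section IntCast

variable {ι : Type*} [Fintype ι] [DecidableEq ι]

omit [Fintype ι] [DecidableEq ι] in
/-- An integer symmetric table casts to a Hermitian matrix. [cite: HornJohnson2013, Observation 7.1.2] -/
theorem isHermitian_map_intCast {Z : Matrix ι ι ℤ} (hZ : Z.IsSymm) : (Z.map (Int.cast : ℤ → 𝕜)).IsHermitian := by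
  refine Matrix.IsHermitian.ext fun i j => ?_
  rw [map_apply, map_apply, RCLike.star_def, map_intCast, ← hZ.apply i j]

omit [DecidableEq ι] in
/-- The norm of a cast integer entry is the cast of its absolute value. [cite: HornJohnson2013, Thm. 6.1.1] -/
theorem norm_intCast_eq (z : ℤ) : ‖(z : 𝕜)‖ = ((|z| : ℤ) : ℝ) := by
  rw [← RCLike.ofReal_intCast, RCLike.norm_ofReal, Int.cast_abs]

/-- **INTEGER DOMINANT SPLIT, general margins.** `Z` an integer symmetric table, LOW/HIGH split by `p`, positive integer margins `e b` dividing a common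
`L > 0`, row dominance of the high rows inside the high block as an INTEGER inequality, and positive semidefiniteness of the cast of the INTEGER low matrix
`S_L a a' = L·Z a a' − Σ_b Z a b · (L / e b) · Z a' b` ⇒ the cast of `Z` is positive semidefinite. [cite: HornJohnson2013, Thm. 6.1.1] [cite: HornJohnson2013, Observation 7.1.2] -/
theorem posSemidef_intCast_of_dominantSplit {Z : Matrix ι ι ℤ} (hZ : Z.IsSymm) (p : ι → Prop) [DecidablePred p]
    (e : {i // ¬ p i} → ℕ) (he : ∀ b, 0 < e b) (L : ℕ) (hL : 0 < L) (hdiv : ∀ b, e b ∣ L)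
    (hdom : ∀ b : {i // ¬ p i}, ∑ b' ∈ univ.erase b, |Z b b'| + (e b : ℤ) ≤ Z b b)
    (hS : ((Matrix.of fun a a' : {i // p i} =>
      (L : ℤ) * Z a a' - ∑ b : {i // ¬ p i}, Z a b * ((L / e b : ℕ) : ℤ) * Z a' b).map (Int.cast : ℤ → 𝕜)).PosSemidef) :
    (Z.map (Int.cast : ℤ → 𝕜)).PosSemidef := by
  have hM := isHermitian_map_intCast (𝕜 := 𝕜) hZ
  refine posSemidef_of_dominantSplit hM p (e := fun b => (e b : ℝ)) (fun b => by exact_mod_cast he b) (fun b => ?_) ?_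
  · -- dominance: integer inequality, cast
    have h := hdom b
    have h1 : ∑ b' ∈ univ.erase b, ‖(Z.map (Int.cast : ℤ → 𝕜)) b b'‖ = ((∑ b' ∈ univ.erase b, |Z b b'| : ℤ) : ℝ) := by
      rw [Int.cast_sum]
      exact Finset.sum_congr rfl fun b' _ => by rw [map_apply, norm_intCast_eq]
    rw [h1, map_apply, RCLike.intCast_re]
    exact_mod_cast h
  · -- the low Schur matrix: `L • schurSplit = cast of the integer matrix`
    refine posSemidef_of_smul_pos (c := (L : ℝ)) (by exact_mod_cast hL) ?_
    convert hS using 1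
    ext a a'
    simp only [Matrix.smul_apply, Matrix.map_apply, Matrix.of_apply, smul_eq_mul, schurSplit, Int.cast_sub, Int.cast_mul, Int.cast_sum,
      Int.cast_natCast, RCLike.star_def, map_intCast]
    rw [mul_sub, Finset.mul_sum]
    congr 1
    · push_cast; ring
    · refine Finset.sum_congr rfl fun b _ => ?_
      have he' : ((e b : ℕ) : 𝕜) ≠ 0 := by exact_mod_cast (he b).ne'
      have hq : ((L / e b : ℕ) : 𝕜) = (L : 𝕜) / (e b : 𝕜) := by
        rw [Nat.cast_div (hdiv b) he']
      rw [hq]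
      push_cast
      field_simp

/-- **INTEGER DOMINANT SPLIT, uniform margin** (`L = e`): `S_e a a' = e·Z a a' − Σ_b Z a b · Z a' b` cast-PSD + integer row dominance ⇒ cast of `Z` PSD.
[cite: HornJohnson2013, Thm. 6.1.1] [cite: HornJohnson2013, Observation 7.1.2] -/
theorem posSemidef_intCast_of_uniformSplit {Z : Matrix ι ι ℤ} (hZ : Z.IsSymm) (p : ι → Prop) [DecidablePred p] (e : ℕ) (he : 0 < e)
    (hdom : ∀ b : {i // ¬ p i}, ∑ b' ∈ univ.erase b, |Z b b'| + (e : ℤ) ≤ Z b b)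
    (hS : ((Matrix.of fun a a' : {i // p i} => (e : ℤ) * Z a a' - ∑ b : {i // ¬ p i}, Z a b * Z a' b).map (Int.cast : ℤ → 𝕜)).PosSemidef) :
    (Z.map (Int.cast : ℤ → 𝕜)).PosSemidef := by
  refine posSemidef_intCast_of_dominantSplit hZ p (fun _ => e) (fun _ => he) e he (fun _ => dvd_rfl) hdom ?_
  have h1 : ((e / e : ℕ) : ℤ) = 1 := by rw [Nat.div_self he, Nat.cast_one]
  simp only [h1, mul_one]
  exact hS

end IntCast

end Literature.Computation.Certificates

end
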